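import Literature.RingTheory.MvPolynomial.DirectrixSpecialization
import Literature.RingTheory.HilbertSamuel.HironakaGrothendieckIsomorphism
import Literature.RingTheory.HilbertSamuel.NormalConeEmbeddingDimension
import Literature.RingTheory.HilbertSamuel.BennettRegularCentre
import Literature.RingTheory.HilbertSamuel.NormalFlatnessCriterionDimOne
import Literature.AlgebraicGeometry.Resolution.QuasiRegularSequences
import Mathlib.RingTheory.LocalRing.ResidueField.Ideal
import HarnessLib

/-!
# The directrix under generization along a permissible centre, dimension-one case:
# `e(A_𝔮) + 1 ≤ e(A)` (Cossart–Jannsen–Saito 2020, Thm. 3.7 with `dim(R/𝔭) = 1`)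

Topic: `Literature/RingTheory/HilbertSamuel`. CJS, LNM 2270, Thm. 3.7 (p. 45): «`e(R_𝔭/J_𝔭) ≤ e(R/J) − dim(R/𝔭)`» for
`J ⊆ 𝔭`, `Spec(R/𝔭) ⊂ Spec(R/J)` permissible. This file proves the case `dim(R/𝔭) = 1` INTRINSICALLY on `A = R/J`
(`dirDim_localization_succ_le_dirDim_of_ringKrullDim_eq_one`), following the book (p. 45–46): the normal-cone ideal
`N ⊆ (A/𝔮)[X]` (`X_i ↦ g_i`, minimal generators of `𝔮`) is realised as the pull-back of the tangent-cone ideal `J_B`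
of `B = A_𝔮` along `(A/𝔮)[X] → κ(𝔮)[X]`; it is saturated, its generic fibre is `J_B` (clearing denominators,
`map_comap_tangentConeIdeal_localization_eq`, CJS (3.4)) and — by NORMAL FLATNESS, i.e. torsion-freeness of the
`𝔮^d/𝔮^{d+1}` (`mem_pow_succ_of_mul_mem_pow_succ`, CJS (3.6)) — its special fibre is `J_D = normalConeIdeal g`
(`map_comap_tangentConeIdeal_localization_eq_normalConeIdeal`). Then Lemma 3.8 / Claim 3.9 over the DVR `A/𝔮`
(`DirectrixSpecialization.lean`) give `dim 𝒯(J_D) ≤ dim 𝒯(J_B)`, and the Hironaka–Grothendieck identity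
`J_z = J_D · k[Z]` (`HerrmannIkedaOrbanz1988_cor_21_11_holds`) gives `e(A) = e(J_z) ≥ e(J_D) + 1 ≥ e(B) + 1`.
The general case and the named fact `CossartJannsenSaito2020_thm_3_7` follow in `DirectrixGenerizationHolds.lean`.
Cell res-hironaka (HIRONAKA-L librarian seat res-D-lib-1; F-64). AI-written; AI review is weaker than expert review.

## References

* V. Cossart, U. Jannsen, S. Saito, *Desingularization: Invariants and Strategy*, LNM 2270 (2020), Thm. 3.7, Lemma 3.8,
  Claim 3.9, (3.4)–(3.6) (p. 45–46); Def. 2.18, Def. 3.1. [CossartJannsenSaito2020]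
-/

noncomputable section

open IsLocalRing MvPolynomial Module
open Literature.RingTheory.MvPolynomial Literature.AlgebraicGeometry.Resolution

namespace Literature.RingTheory.HilbertSamuel

universe u

variable {A : Type u} [CommRing A]

/-! ## Small helpers -/

/-- A homogeneous polynomial over a quotient `A/𝔮` lifts to a homogeneous polynomial over `A`. [folklore] -/
private theorem exists_isHomogeneous_map_mk_eq {m : ℕ} (𝔮 : Ideal A) {d : ℕ} (φ : MvPolynomial (Fin m) (A ⧸ 𝔮))
    (hφ : φ.IsHomogeneous d) :
    ∃ F : MvPolynomial (Fin m) A, F.IsHomogeneous d ∧ MvPolynomial.map (Ideal.Quotient.mk 𝔮) F = φ := by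
  classical
  choose lift hlift using fun c : A ⧸ 𝔮 => Ideal.Quotient.mk_surjective c
  refine ⟨∑ u ∈ φ.support, monomial u (lift (coeff u φ)), ?_, ?_⟩
  · refine IsHomogeneous.sum _ _ _ fun u hu => isHomogeneous_monomial _ ?_
    rw [Finsupp.degree_eq_weight_one]; exact hφ (mem_support_iff.mp hu)
  · rw [map_sum]
    simp only [map_monomial, hlift]
    exact φ.as_sum.symm

/-- Minimal generators of a finitely generated ideal as a `Fin μ(I)`-indexed family. [folklore] -/
private theorem exists_fun_span_eq {I : Ideal A} (hI : I.FG) :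
    ∃ g : Fin I.spanFinrank → A, Ideal.span (Set.range g) = I := by
  classical
  obtain ⟨s, hs, hspan⟩ := Submodule.FG.exists_span_finset_card_eq_spanFinrank hI
  refine ⟨fun i => (s.equivFin.symm (Fin.cast hs.symm i) : A), ?_⟩
  have hrange : Set.range (fun i : Fin I.spanFinrank => (s.equivFin.symm (Fin.cast hs.symm i) : A)) = (s : Set A) := by
    ext a
    constructor
    · rintro ⟨i, rfl⟩; exact Finset.coe_mem _
    · intro ha
      exact ⟨Fin.cast hs (s.equivFin ⟨a, ha⟩), by simp⟩
  rw [hrange]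
  exact hspan

/-! ## Torsion-freeness of the graded pieces along a normally flat prime -/

/-- Along a NORMALLY FLAT prime the graded pieces `𝔮^d/𝔮^{d+1}` are torsion-free over `A/𝔮`:
`s ∉ 𝔮`, `y ∈ 𝔮^d`, `s y ∈ 𝔮^{d+1} ⇒ y ∈ 𝔮^{d+1}` (CJS (3.6): «the flatness of `gr_𝔭(R/J)` implies
`In_𝔭(J)_K ∩ gr_𝔭(R) = In_𝔭(J)`»). [cite: CossartJannsenSaito2020, Thm. 3.7 (proof, (3.6))] -/
theorem mem_pow_succ_of_mul_mem_pow_succ (𝔮 : Ideal A) [𝔮.IsPrime] (hNF : 𝔮.IsNormallyFlat) {d : ℕ} {s y : A}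
    (hs : s ∉ 𝔮) (hy : y ∈ 𝔮 ^ d) (hsy : s * y ∈ 𝔮 ^ (d + 1)) : y ∈ 𝔮 ^ (d + 1) := by
  haveI := hNF d
  have hs0 : Ideal.Quotient.mk 𝔮 s ≠ 0 := fun h0 => hs (Ideal.Quotient.eq_zero_iff_mem.mp h0)
  have hsm : IsSMulRegular (gradedPiece 𝔮 d) (Ideal.Quotient.mk 𝔮 s) :=
    Module.IsTorsionFree.isSMulRegular (IsRegular.of_ne_zero' hs0)
  have h0 : (Ideal.Quotient.mk 𝔮 s) • gradedPiece.mk 𝔮 d ⟨y, hy⟩ = (Ideal.Quotient.mk 𝔮 s) • 0 := by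
    rw [smul_zero]; change s • gradedPiece.mk 𝔮 d ⟨y, hy⟩ = 0
    rw [← map_smul, gradedPiece.mk_eq_zero_iff]; exact hsy
  exact (gradedPiece.mk_eq_zero_iff 𝔮 d ⟨y, hy⟩).mp (hsm h0)

/-! ## The normal-cone ideal over `A/𝔮` as the pull-back of the tangent cone of `A_𝔮` -/

section NormalCone

variable (𝔮 : Ideal A) [𝔮.IsPrime] {m : ℕ} (g : Fin m → A)

/-- The images of generators of `𝔮` generate the maximal ideal of `A_𝔮`. [folklore] -/
private theorem span_range_algebraMap_localization_eq (hg : Ideal.span (Set.range g) = 𝔮) :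
    Ideal.span (Set.range fun i => algebraMap A (Localization.AtPrime 𝔮) (g i)) =
      maximalIdeal (Localization.AtPrime 𝔮) := by
  have h : Ideal.map (algebraMap A (Localization.AtPrime 𝔮)) (Ideal.span (Set.range g)) =
      Ideal.span (Set.range fun i => algebraMap A (Localization.AtPrime 𝔮) (g i)) := by
    rw [Ideal.map_span, ← Set.range_comp]; rfl
  rw [← Localization.AtPrime.map_eq_maximalIdeal, ← h, hg]

/-- The coefficient map `(A/𝔮)[X] → κ(𝔮)[X]` composed with reduction mod `𝔮` is reduction along `A → A_𝔮 → κ(𝔮)`.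
[folklore] -/
private theorem map_algebraMap_map_mk (F : MvPolynomial (Fin m) A) :
    MvPolynomial.map (algebraMap (A ⧸ 𝔮) 𝔮.ResidueField) (MvPolynomial.map (Ideal.Quotient.mk 𝔮) F) =
      MvPolynomial.map (residue (Localization.AtPrime 𝔮)) (MvPolynomial.map (algebraMap A (Localization.AtPrime 𝔮)) F) := by
  rw [map_map, map_map]
  rfl

variable {𝔮 g}

/-- `F_B(g_B) = F(g)` in `A_𝔮` for the image `F_B` of a polynomial `F` over `A`. [folklore] -/
private theorem eval_map_algebraMap (F : MvPolynomial (Fin m) A) :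
    eval (fun i => algebraMap A (Localization.AtPrime 𝔮) (g i))
        (MvPolynomial.map (algebraMap A (Localization.AtPrime 𝔮)) F) =
      algebraMap A (Localization.AtPrime 𝔮) (eval g F) := by
  rw [eval_map, show (fun i => algebraMap A (Localization.AtPrime 𝔮) (g i)) =
    (algebraMap A (Localization.AtPrime 𝔮)) ∘ g from rfl]
  have h := eval₂_comp_left (algebraMap A (Localization.AtPrime 𝔮)) (RingHom.id A) g F
  rw [RingHom.comp_id] at h
  exact h.symm

/-- **Membership in the normal-cone ideal over `A/𝔮` (CJS (3.5))**, easy half: if `F(g) ∈ 𝔮^{d+1}` for a form `F` of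
degree `d` over `A`, the reduction of `F` lies in the tangent-cone ideal of `A_𝔮`. [cite: CossartJannsenSaito2020, Thm. 3.7 (3.5)] -/
theorem map_mem_tangentConeIdeal_localization_of_eval_mem
    (hgB : Ideal.span (Set.range fun i => algebraMap A (Localization.AtPrime 𝔮) (g i)) =
      maximalIdeal (Localization.AtPrime 𝔮))
    {d : ℕ} {F : MvPolynomial (Fin m) A} (hF : F.IsHomogeneous d) (hFg : eval g F ∈ 𝔮 ^ (d + 1)) :
    MvPolynomial.map (algebraMap (A ⧸ 𝔮) 𝔮.ResidueField) (MvPolynomial.map (Ideal.Quotient.mk 𝔮) F) ∈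
      tangentConeIdeal _ hgB := by
  rw [map_algebraMap_map_mk]
  refine mem_tangentConeIdeal_of_mem_symbolForms _ hgB d ((mem_symbolForms_iff_exists_form _ hgB).mpr
    ⟨MvPolynomial.map (algebraMap A (Localization.AtPrime 𝔮)) F, hF.map _, ?_, rfl⟩)
  rw [eval_map_algebraMap, ← Localization.AtPrime.map_eq_maximalIdeal, ← Ideal.map_pow]
  exact Ideal.mem_map_of_mem _ hFg

/-- **Membership in the normal-cone ideal over `A/𝔮`, converse under NORMAL FLATNESS (CJS (3.6))**: if the reduction of
a form `F` of degree `d` over `A` lies in the tangent-cone ideal of `A_𝔮`, then `F(g) ∈ 𝔮^{d+1}` — some `s ∉ 𝔮` has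
`s F(g) ∈ 𝔮^{d+1}`, and `𝔮^d/𝔮^{d+1}` is torsion-free. [cite: CossartJannsenSaito2020, Thm. 3.7 (proof, (3.6))] -/
theorem eval_mem_pow_succ_of_map_mem_tangentConeIdeal_localization (hNF : 𝔮.IsNormallyFlat)
    (hg : Ideal.span (Set.range g) = 𝔮)
    (hgB : Ideal.span (Set.range fun i => algebraMap A (Localization.AtPrime 𝔮) (g i)) =
      maximalIdeal (Localization.AtPrime 𝔮))
    {d : ℕ} {F : MvPolynomial (Fin m) A} (hF : F.IsHomogeneous d)
    (hmem : MvPolynomial.map (algebraMap (A ⧸ 𝔮) 𝔮.ResidueField) (MvPolynomial.map (Ideal.Quotient.mk 𝔮) F) ∈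
      tangentConeIdeal _ hgB) : eval g F ∈ 𝔮 ^ (d + 1) := by
  set B := Localization.AtPrime 𝔮 with hB
  set FB := MvPolynomial.map (algebraMap A B) F with hFB
  rw [map_algebraMap_map_mk] at hmem
  -- the reduction is a symbol form of degree `d`
  have hsym : MvPolynomial.map (residue B) FB ∈ symbolForms _ hgB d := by
    rw [← idealDegree_tangentConeIdeal]
    exact mem_idealDegree.mpr ⟨hmem, (hF.map _).map _⟩
  obtain ⟨G, hG, hGg, hGF⟩ := (mem_symbolForms_iff_exists_form _ hgB).mp hsym
  -- `G − F_B` has coefficients in `𝔫`, so `F_B(g) ∈ 𝔫^{d+1}` too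
  have hcoef : G - FB ∈ Ideal.map C (maximalIdeal B) := by
    rw [mem_map_C_iff]
    intro u
    rw [coeff_sub, ← residue_eq_zero_iff, map_sub, sub_eq_zero, ← coeff_map, ← coeff_map, hGF]
  have hdiff : eval (fun i => algebraMap A B (g i)) (G - FB) ∈ maximalIdeal B ^ (d + 1) := by
    have h := eval_mem_mul_span_pow (fun i => algebraMap A B (g i)) (hG.sub (hF.map _)) hcoef
    rw [hgB, ← pow_succ'] at h
    exact h
  have hFBg : eval (fun i => algebraMap A B (g i)) FB ∈ maximalIdeal B ^ (d + 1) := by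
    have : eval (fun i => algebraMap A B (g i)) FB =
        eval (fun i => algebraMap A B (g i)) G - eval (fun i => algebraMap A B (g i)) (G - FB) := by
      rw [map_sub]; ring
    rw [this]
    exact sub_mem hGg hdiff
  rw [hFB, eval_map_algebraMap, ← Localization.AtPrime.map_eq_maximalIdeal, ← Ideal.map_pow,
    IsLocalization.algebraMap_mem_map_algebraMap_iff 𝔮.primeCompl] at hFBg
  obtain ⟨s, hs, hsF⟩ := hFBg
  have hFd : eval g F ∈ 𝔮 ^ d := by
    rw [← hg]
    exact (Ideal.mem_span_pow_iff_exists_isHomogeneous g _).mpr ⟨F, hF, rfl⟩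
  exact mem_pow_succ_of_mul_mem_pow_succ 𝔮 hNF hs hFd hsF

/-- **The generic fibre**: the tangent-cone ideal `J_B` of `B = A_𝔮` is the extension of its pull-back `N ⊆ (A/𝔮)[X]`
(«`In_𝔭(J)_K`», CJS (3.4)): every symbol form of `B` is, up to a unit of `κ(𝔮)`, the reduction of a form over `A`
(clearing denominators). [cite: CossartJannsenSaito2020, Thm. 3.7 (proof, (3.4)–(3.6))] -/
theorem map_comap_tangentConeIdeal_localization_eq
    (hgB : Ideal.span (Set.range fun i => algebraMap A (Localization.AtPrime 𝔮) (g i)) =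
      maximalIdeal (Localization.AtPrime 𝔮)) :
    ((tangentConeIdeal _ hgB).comap (MvPolynomial.map (algebraMap (A ⧸ 𝔮) 𝔮.ResidueField))).map
        (MvPolynomial.map (algebraMap (A ⧸ 𝔮) 𝔮.ResidueField)) = tangentConeIdeal _ hgB := by
  classical
  set B := Localization.AtPrime 𝔮 with hB
  set ι := algebraMap (A ⧸ 𝔮) 𝔮.ResidueField with hι
  refine le_antisymm Ideal.map_comap_le ?_
  -- generators: symbol forms
  rw [tangentConeIdeal, Ideal.span_le]
  intro f hf
  obtain ⟨d, hfd⟩ := Set.mem_iUnion.mp hf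
  obtain ⟨G, hG, hGg, rfl⟩ := (mem_symbolForms_iff_exists_form _ hgB).mp hfd
  -- clear the denominators of the coefficients of `G`
  obtain ⟨s, hs⟩ := IsLocalization.exist_integer_multiples_of_finite 𝔮.primeCompl
    (fun u : G.support => coeff (u : Fin m →₀ ℕ) G)
  choose r hr using hs
  set F : MvPolynomial (Fin m) A := ∑ u : G.support, monomial (u : Fin m →₀ ℕ) (r u) with hF
  have hFB : MvPolynomial.map (algebraMap A B) F = C (algebraMap A B s) * G := by
    rw [hF, map_sum]
    simp only [map_monomial]
    conv_rhs => rw [G.as_sum, Finset.mul_sum]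
    rw [← Finset.sum_coe_sort G.support]
    refine Finset.sum_congr rfl fun u _ => ?_
    rw [C_mul_monomial, hr u, Algebra.smul_def]
  have hFhom : F.IsHomogeneous d := by
    rw [hF]
    refine IsHomogeneous.sum _ _ _ fun u _ => isHomogeneous_monomial _ ?_
    rw [Finsupp.degree_eq_weight_one]; exact hG (mem_support_iff.mp u.2)
  -- `F̄ ∈ N`
  have hFN : MvPolynomial.map (Ideal.Quotient.mk 𝔮) F ∈
      (tangentConeIdeal _ hgB).comap (MvPolynomial.map ι) := by
    rw [Ideal.mem_comap, hι, map_algebraMap_map_mk, hFB, map_mul, map_C]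
    exact Ideal.mul_mem_left _ _ (mem_tangentConeIdeal_of_mem_symbolForms _ hgB d hfd)
  -- `f = (residue s)⁻¹ • ι F̄`
  have hunit : residue B (algebraMap A B s) ≠ 0 := by
    rw [ne_eq, residue_eq_zero_iff, ← Localization.AtPrime.map_eq_maximalIdeal,
      IsLocalization.algebraMap_mem_map_algebraMap_iff 𝔮.primeCompl]
    rintro ⟨t, ht, hts⟩
    exact (‹𝔮.IsPrime›.mem_or_mem hts).elim ht s.2
  have hrel : MvPolynomial.map ι (MvPolynomial.map (Ideal.Quotient.mk 𝔮) F) =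
      C (residue B (algebraMap A B s)) * MvPolynomial.map (residue B) G := by
    rw [hι, map_algebraMap_map_mk, hFB, map_mul, map_C]
  have : MvPolynomial.map (residue B) G =
      C (residue B (algebraMap A B s))⁻¹ * MvPolynomial.map ι (MvPolynomial.map (Ideal.Quotient.mk 𝔮) F) := by
    rw [hrel, ← mul_assoc, ← C_mul, inv_mul_cancel₀ hunit, C_1, one_mul]
  rw [this]
  exact Ideal.mul_mem_left _ _ (Ideal.mem_map_of_mem _ hFN)

/-- **The special fibre under NORMAL FLATNESS**: the reduction mod `𝔪_A` of the pull-back `N ⊆ (A/𝔮)[X]` of the tangent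
cone of `A_𝔮` is the ideal `J_D = normalConeIdeal g` of the fibre of the normal cone at the closed point (CJS: the
special fibre of `In_𝔭(J)` is the ideal of `C_{X,D,x}`). [cite: CossartJannsenSaito2020, Thm. 3.7 (proof, Lemma 3.8)] -/
theorem map_comap_tangentConeIdeal_localization_eq_normalConeIdeal [IsLocalRing A] (hNF : 𝔮.IsNormallyFlat)
    (hg : Ideal.span (Set.range g) = 𝔮)
    (hgB : Ideal.span (Set.range fun i => algebraMap A (Localization.AtPrime 𝔮) (g i)) =
      maximalIdeal (Localization.AtPrime 𝔮))
    (π : A ⧸ 𝔮 →+* ResidueField A) (hπ : π.comp (Ideal.Quotient.mk 𝔮) = residue A) :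
    ((tangentConeIdeal _ hgB).comap (MvPolynomial.map (algebraMap (A ⧸ 𝔮) 𝔮.ResidueField))).map
        (MvPolynomial.map π) = normalConeIdeal g := by
  classical
  set ι := algebraMap (A ⧸ 𝔮) 𝔮.ResidueField with hι
  set N := (tangentConeIdeal _ hgB).comap (MvPolynomial.map ι) with hN
  have hπmap : ∀ F : MvPolynomial (Fin m) A,
      MvPolynomial.map π (MvPolynomial.map (Ideal.Quotient.mk 𝔮) F) = MvPolynomial.map (residue A) F := fun F => by
    rw [map_map, hπ]
  have h𝔮m : 𝔮 ≤ maximalIdeal A := IsLocalRing.le_maximalIdeal (Ideal.IsPrime.ne_top ‹_›)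
  apply le_antisymm
  · -- `π(N) ⊆ J_D`: homogeneous components of members of `N` are members; lift them to forms over `A`
    rw [Ideal.map, Ideal.span_le]
    rintro _ ⟨n, hn, rfl⟩
    rw [SetLike.mem_coe, ← sum_homogeneousComponent n, map_sum]
    refine Ideal.sum_mem _ fun d _ => ?_
    have hnd : homogeneousComponent d n ∈ N := by
      rw [hN, Ideal.mem_comap, ← homogeneousComponent_map]
      exact isHomogeneousIdeal_tangentConeIdeal _ hgB _ hn d
    obtain ⟨F, hF, hFn⟩ := exists_isHomogeneous_map_mk_eq 𝔮 _ (homogeneousComponent_isHomogeneous d n)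
    have hFg : eval g F ∈ 𝔮 ^ (d + 1) :=
      eval_mem_pow_succ_of_map_mem_tangentConeIdeal_localization hNF hg hgB hF (by rw [hFn]; exact hnd)
    rw [← hFn, hπmap]
    refine mem_normalConeIdeal_of_mem_normalConeForms g ⟨F, hF, ?_, rfl⟩
    rw [pow_succ'] at hFg
    rw [hg]
    exact Ideal.mul_mono_left h𝔮m hFg
  · -- `J_D ⊆ π(N)`: a relation `F(g) ∈ 𝔪 𝔮^d` is corrected by a form with coefficients in `𝔪` to `F'(g) = 0`
    rw [normalConeIdeal, Ideal.span_le]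
    intro f hf
    obtain ⟨d, hfd⟩ := Set.mem_iUnion.mp hf
    obtain ⟨F, hF, hFg, rfl⟩ := hfd
    -- `F(g) = M(g)` with `M` a form of degree `d` with coefficients in `𝔪`
    have key : ∀ x ∈ maximalIdeal A * Ideal.span (Set.range g) ^ d, ∃ M : MvPolynomial (Fin m) A,
        M.IsHomogeneous d ∧ eval g M = x ∧ MvPolynomial.map (residue A) M = 0 := by
      intro x hx
      refine Submodule.mul_induction_on hx ?_ ?_
      · intro a ha b hb
        obtain ⟨Y, hY, rfl⟩ := (Ideal.mem_span_pow_iff_exists_isHomogeneous g b).mp hb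
        refine ⟨C a * Y, hY.C_mul a, by rw [map_mul, eval_C], ?_⟩
        rw [map_mul, map_C, (residue_eq_zero_iff a).mpr ha, C_0, zero_mul]
      · rintro x y ⟨M₁, hM₁, rfl, h₁⟩ ⟨M₂, hM₂, rfl, h₂⟩
        exact ⟨M₁ + M₂, hM₁.add hM₂, by rw [map_add], by rw [map_add, h₁, h₂, add_zero]⟩
    obtain ⟨M, hM, hMg, hM0⟩ := key _ hFg
    have hF'g : eval g (F - M) ∈ 𝔮 ^ (d + 1) := by rw [map_sub, hMg, sub_self]; exact Ideal.zero_mem _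
    have hF'N : MvPolynomial.map (Ideal.Quotient.mk 𝔮) (F - M) ∈ N :=
      map_mem_tangentConeIdeal_localization_of_eval_mem hgB (hF.sub hM) hF'g
    have : MvPolynomial.map (residue A) F = MvPolynomial.map π (MvPolynomial.map (Ideal.Quotient.mk 𝔮) (F - M)) := by
      rw [hπmap, map_sub, hM0, sub_zero]
    rw [SetLike.mem_coe, this]
    exact Ideal.mem_map_of_mem _ hF'N

/-- The pull-back `N` is SATURATED: `c ≠ 0`, `c φ ∈ N ⇒ φ ∈ N` (contraction along an injective coefficient map into
a field). [cite: CossartJannsenSaito2020, Thm. 3.7 (proof, (3.6))] -/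
theorem saturated_comap_tangentConeIdeal_localization
    (hgB : Ideal.span (Set.range fun i => algebraMap A (Localization.AtPrime 𝔮) (g i)) =
      maximalIdeal (Localization.AtPrime 𝔮))
    (c : A ⧸ 𝔮) (φ : MvPolynomial (Fin m) (A ⧸ 𝔮)) (hc : c ≠ 0)
    (h : C c * φ ∈ (tangentConeIdeal _ hgB).comap (MvPolynomial.map (algebraMap (A ⧸ 𝔮) 𝔮.ResidueField))) :
    φ ∈ (tangentConeIdeal _ hgB).comap (MvPolynomial.map (algebraMap (A ⧸ 𝔮) 𝔮.ResidueField)) := by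
  set ι := algebraMap (A ⧸ 𝔮) 𝔮.ResidueField with hι
  rw [Ideal.mem_comap] at h ⊢
  rw [map_mul, map_C] at h
  have hιc : ι c ≠ 0 := (map_ne_zero_iff ι (IsFractionRing.injective (A ⧸ 𝔮) 𝔮.ResidueField)).mpr hc
  have := Ideal.mul_mem_left _ (C (ι c)⁻¹) h
  rwa [← mul_assoc, ← C_mul, inv_mul_cancel₀ hιc, C_1, one_mul] at this

end NormalCone

/-! ## The dimension-one case of CJS Thm. 3.7 -/

section DimOne

variable [IsLocalRing A] [IsNoetherianRing A]

/-- **CJS Thm. 3.7 for `dim(A/𝔮) = 1` (intrinsic form): `e(A_𝔮) + 1 ≤ e(A)`** for a noetherian local ring `A` and a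
prime `𝔮` with `A/𝔮` regular of dimension `1` along which `A` is normally flat. Proof = the book's: Lemma 3.8 / Claim 3.9
over the DVR `A/𝔮` (`finrank_directrixSpace_map_le_of_saturated`) applied to the pull-back `N` of the tangent cone of
`A_𝔮` (generic fibre the tangent cone of `A_𝔮`, special fibre `normalConeIdeal g` by normal flatness), and the
Hironaka–Grothendieck identity `J_z = J_D · k[Z]` (`HerrmannIkedaOrbanz1988_cor_21_11_holds`) for the minimal system
`z = (g, y)`. [cite: CossartJannsenSaito2020, Thm. 3.7 (case dim R/𝔭 = 1), Lemma 3.8, Claim 3.9] -/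
theorem dirDim_localization_succ_le_dirDim_of_ringKrullDim_eq_one (𝔮 : Ideal A) [𝔮.IsPrime]
    [IsRegularLocalRing (A ⧸ 𝔮)] (hNF : 𝔮.IsNormallyFlat) (hd1 : ringKrullDim (A ⧸ 𝔮) = 1) :
    dirDim (Localization.AtPrime 𝔮) + 1 ≤ dirDim A := by
  classical
  set B := Localization.AtPrime 𝔮 with hB
  haveI : IsNoetherianRing B := IsLocalization.isNoetherianRing 𝔮.primeCompl B inferInstance
  set ι := algebraMap (A ⧸ 𝔮) 𝔮.ResidueField with hι
  -- `A/𝔮` is a DVR, `𝔪 = 𝔮 + (f)`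
  obtain ⟨⟨f, hf⟩, h𝔮ne⟩ := exists_maximalIdeal_eq_sup_span_of_isRegularLocalRing 𝔮 hd1
  haveI : IsPrincipalIdealRing (A ⧸ 𝔮) := isPrincipalIdealRing_quotient_of_sup_span_eq 𝔮 hf
  -- minimal generators `g` of `𝔮`
  set m := 𝔮.spanFinrank with hm
  obtain ⟨g, hg⟩ := exists_fun_span_eq (I := 𝔮) (IsNoetherian.noetherian 𝔮)
  have hgB : Ideal.span (Set.range fun i => algebraMap A B (g i)) = maximalIdeal B :=
    span_range_algebraMap_localization_eq 𝔮 g hg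
  -- `z = (g, f)` generates `𝔪`
  set y : Fin 1 → A := fun _ => f with hy
  have hz : Ideal.span (Set.range (Fin.append g y)) = maximalIdeal A := by
    apply le_antisymm
    · refine Ideal.span_le.mpr (Set.range_subset_iff.mpr (Fin.addCases (fun l => ?_) fun l => ?_))
      · rw [Fin.append_left, SetLike.mem_coe, hf]; exact Ideal.mem_sup_left (hg ▸ Ideal.subset_span ⟨l, rfl⟩)
      · rw [Fin.append_right, SetLike.mem_coe, hf]; exact Ideal.mem_sup_right (Ideal.mem_span_singleton_self f)
    · rw [hf, sup_le_iff, Ideal.span_singleton_le_iff_mem]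
      exact ⟨hg.symm.trans_le (Ideal.span_mono (Set.range_subset_iff.mpr fun l =>
        ⟨Fin.castAdd 1 l, Fin.append_left g y l⟩)), Ideal.subset_span ⟨Fin.natAdd m 0, Fin.append_right g y 0⟩⟩
  -- Hironaka–Grothendieck: `J_z = J_D · k[Z]`, so `z` is minimal and `e(A) ≥ e(J_D) + 1`
  have hJz := HerrmannIkedaOrbanz1988_cor_21_11_holds A 𝔮 m 1 g y hz hg ‹_› hNF hd1
  have hE : (maximalIdeal A).spanFinrank = m + 1 :=
    spanFinrank_maximalIdeal_eq_of_tangentConeIdeal_eq (by rw [hg]) hz hJz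
  have heA : dirDim A = directrixDim (tangentConeIdeal (Fin.append g y) hz) := dirDim_eq' A hE _ hz
  have hstep : directrixDim (normalConeIdeal g) + 1 ≤ dirDim A := by
    rw [heA, hJz]
    exact directrixDim_add_le_directrixDim_map_rename 1 (normalConeIdeal g)
  -- `μ(𝔫) = m` for `𝔫 = 𝔮B`, so `e(B) = e(J_B)`
  have heB : (maximalIdeal B).spanFinrank = m := by
    apply le_antisymm
    · rw [← hgB]
      refine (Submodule.spanFinrank_span_le_ncard_of_finite (Set.finite_range _)).trans ?_
      have h1 : (Set.range fun i => algebraMap A B (g i)).ncard ≤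
          (Finset.univ.image fun i => algebraMap A B (g i)).card := by
        rw [← Set.ncard_coe_finset, Finset.coe_image, Finset.coe_univ, Set.image_univ]
      exact h1.trans (Finset.card_image_le.trans (by rw [Finset.card_univ, Fintype.card_fin]))
    · haveI : Module.Free (A ⧸ 𝔮) (gradedPiece 𝔮 1) := by
        haveI := hNF 1
        haveI : Module.Finite (A ⧸ 𝔮) (gradedPiece 𝔮 1) := Module.Finite.of_restrictScalars_finite A _ _
        exact Module.free_of_flat_of_isLocalRing
      have h1 := spanFinrank_pow_le_hilbertFun_of_free 𝔮 B 1
      rw [pow_one, hilbertFun_eq_spanFinrank_pow, pow_one] at h1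
      rw [hm]; exact h1
  have heBJ : dirDim B = directrixDim (tangentConeIdeal _ hgB) := dirDim_eq' B heB _ hgB
  -- Lemma 3.8 / Claim 3.9 over the DVR `A/𝔮` for the pull-back `N`
  set N := (tangentConeIdeal _ hgB).comap (MvPolynomial.map ι) with hN
  have hsat : ∀ (c : A ⧸ 𝔮) (φ : MvPolynomial (Fin m) (A ⧸ 𝔮)), c ≠ 0 → C c * φ ∈ N → φ ∈ N :=
    fun c φ hc h => saturated_comap_tangentConeIdeal_localization hgB c φ hc h
  -- the reduction `A/𝔮 → k`
  have h𝔮m : 𝔮 ≤ maximalIdeal A := IsLocalRing.le_maximalIdeal (Ideal.IsPrime.ne_top ‹_›)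
  set π : A ⧸ 𝔮 →+* ResidueField A := Ideal.Quotient.lift 𝔮 (residue A)
    (fun a ha => (residue_eq_zero_iff a).mpr (h𝔮m ha)) with hπ
  have hπc : π.comp (Ideal.Quotient.mk 𝔮) = residue A :=
    RingHom.ext fun a => by rw [RingHom.comp_apply, hπ, Ideal.Quotient.lift_mk]
  have hineq : finrank (ResidueField A) (directrixSpace (normalConeIdeal g)) ≤
      finrank 𝔮.ResidueField (directrixSpace (tangentConeIdeal _ hgB)) := by
    have h := finrank_directrixSpace_map_le_of_saturated (K := 𝔮.ResidueField) hsat π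
    rwa [map_comap_tangentConeIdeal_localization_eq_normalConeIdeal hNF hg hgB π hπc,
      map_comap_tangentConeIdeal_localization_eq hgB] at h
  -- `e = m − dim 𝒯`
  have hD : finrank (ResidueField A) (directrixSpace (normalConeIdeal g)) + directrixDim (normalConeIdeal g) = m :=
    finrank_directrixSpace_add_directrixDim _
  have hB' : finrank 𝔮.ResidueField (directrixSpace (tangentConeIdeal _ hgB)) +
      directrixDim (tangentConeIdeal _ hgB) = m :=
    finrank_directrixSpace_add_directrixDim _
  rw [heBJ]
  omega

end DimOne

end Literature.RingTheory.HilbertSamuel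

end
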